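import Summits.Ventures.DiscreteObjects.Hadamard.Order334ItoTfae668
import Summits.Ventures.DiscreteObjects.Hadamard.Order167WilliamsonIff668
import Summits.Ventures.DiscreteObjects.Hadamard.Order167CirculantArray668

/-!
# H(668): the web of implications between the typed families of the 167-local dictionary (kernel; existence level)

Framing: lottery ticket; floor = certified bounds/negative ranges.

Cell pub-namedobj (venture DiscreteObjects), target (H), hadamard gen 23.  The 167-local dictionary of a hypothetical H(668)
(σ of pair order 167 in Aut±; `C̄ = C(σ)/±⟨σ⟩ ≤ V₄`, `N̄ = N(⟨σ⟩)/±⟨σ⟩` elementary abelian of order ≤ 8) is, at EXISTENCE level,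
a list of kernel iffs with typed arrays of circulant `±1` blocks of order 167 on the right:
`N̄ = 1` ⇔ sixteen circulants (gen 19, `hadamard668_aut167_iff_circulantArray`); block-preserving inversion ⇔ sixteen SYMMETRIC
circulants (gen 20, `hadamard668_aut167_inverting_iff_symmetricCirculantArray`); fixed-point-free inversion ⇔ blocks paired under
transposition (gen 23, `hadamard668_aut167_inverting_fpf_iff_pairedCirculantArray`); `|C̄| ≥ 2` ⇔ order 334 ⇔ NGP(334) ⇔ ITO TYPE
(gen 23, `hadamard668_order334_tfae`); `C̄ = V₄` ⇔ WILLIAMSON TYPE (gen 21, `hadamard668_index_four_iff_williamsonType`); order 334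
with a row-fixing inverting element ⇔ `|N̄| = 8` ⇔ WILLIAMSON SEQUENCES (gen 22/23,
`hadamard668_order334_inverting_fixed_iff_williamsonSequences`, `hadamard668_normalizer_index_eight_iff_williamsonSequences`).
This file records the IMPLICATIONS between the right-hand sides that the census gives for free (all at order 668):
* **`hadamard668_williamsonType_implies_itoMatrix`**: a Williamson-TYPE H(668) (gen 21's `V₄`-twisted four-circulant array, blocks
  not necessarily symmetric) yields an Ito-type quadruple of order 167 [the centralising involution `τ₁` gives `τ₁σ` of pair order
  334; then `hadamard668_order334_tfae`] — the kernel form at 668 of 'Williamson Hadamard matrices with circulant components are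
  Ito Hadamard matrices' (Horadam 2007 §6.4.4, p.180); gen 22's `williamsonSequences_imply_itoQuadruple` was the symmetric case.
* **`hadamard668_itoMatrix_implies_circulantArray`**: an Ito-type quadruple of order 167 yields a Hadamard `4 × 4` array of sixteen
  circulant blocks (order 334 ⇒ `167 ∣` the pair order; gen 19) — trivial but recorded for the table.
* **`hadamard668_index_four_implies_order334`**: gen 21's index-4 configuration yields an element of pair order 334 (packaging).
So the families are nested Williamson sequences ⊂ Williamson type ⊂ Ito type ⊂ sixteen circulants at the level of existence
statements, each inclusion a kernel implication.  DICTIONARY only; every family OPEN at 167; no order excluded; H(668) untouched.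
Ours; no `sorry`, no definitions, default heartbeats.
-/

namespace Summit.Ventures.DiscreteObjects.Hadamard

open Finset BigOperators Matrix

open Literature.Combinatorics.Designs.GoethalsSeidel (IsHadamardMatrix)
open Literature.Combinatorics.Designs.ItoArray (itoMatrix)

/-- **Index 4 at an element of order 167 ⇒ an element of pair order 334** (packaging of gen 21's
`centralizer167_involution_mul_orderOf`). -/
theorem hadamard668_index_four_implies_order334
    (hyp : ∃ (ι : Type) (_ : Fintype ι) (_ : DecidableEq ι) (H : Matrix ι ι ℤ) (π κ π₁ κ₁ π₂ κ₂ : Equiv.Perm ι)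
        (d e d₁ e₁ d₂ e₂ : ι → ℤ), Fintype.card ι = 668 ∧ IsHadamardMatrix H ∧ IsSignedAut H π κ d e ∧ π ^ 167 = 1 ∧
        κ ^ 167 = 1 ∧ (π ≠ 1 ∨ κ ≠ 1) ∧ IsSignedAut H π₁ κ₁ d₁ e₁ ∧ IsSignedAut H π₂ κ₂ d₂ e₂ ∧ Commute π₁ π ∧ Commute κ₁ κ ∧
        Commute π₂ π ∧ Commute κ₂ κ ∧ π₁ ^ 2 = 1 ∧ κ₁ ^ 2 = 1 ∧ π₂ ^ 2 = 1 ∧ κ₂ ^ 2 = 1 ∧ (π₁ ≠ 1 ∨ κ₁ ≠ 1) ∧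
        (π₂ ≠ 1 ∨ κ₂ ≠ 1) ∧ (π₁ ≠ π₂ ∨ κ₁ ≠ κ₂)) :
    ∃ (ι : Type) (_ : Fintype ι) (_ : DecidableEq ι) (H : Matrix ι ι ℤ) (π κ : Equiv.Perm ι) (d e : ι → ℤ),
      Fintype.card ι = 668 ∧ IsHadamardMatrix H ∧ IsSignedAut H π κ d e ∧
      orderOf ((π, κ) : Equiv.Perm ι × Equiv.Perm ι) = 334 := by
  obtain ⟨ι, _, _, H, π, κ, π₁, κ₁, π₂, κ₂, d, e, d₁, e₁, d₂, e₂, hι, hH, haut, hπ, hκ, hne, h₁, -, hc₁, hc₁', -, -, hi₁, hi₁',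
    -, -, hne₁, -, -⟩ := hyp
  exact ⟨ι, inferInstance, inferInstance, H, π₁ * π, κ₁ * κ, _, _, hι, hH, isSignedAut_mul h₁ haut,
    centralizer167_involution_mul_orderOf hπ hκ hne hc₁ hc₁' hi₁ hi₁' hne₁⟩

/-- **Williamson TYPE ⇒ Ito type (order 668, kernel).**  If gen 21's `V₄`-twisted four-circulant (Williamson-type) array on some
`A : V₄ → ℤ/167 → ℤ` is a Hadamard matrix, then an Ito-type quadruple of order 167 exists. -/
theorem hadamard668_williamsonType_implies_itoMatrix
    (hyp : ∃ A : ZMod 2 × ZMod 2 → ZMod 167 → ℤ,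
      IsHadamardMatrix (Matrix.of fun (a b : (ZMod 2 × ZMod 2) × ZMod 167) =>
        (if a.1 = 0 then (1 : ℤ) else if a.1 = (1, 0) then (if b.1.1 = 1 then 1 else -1)
          else if a.1 = (0, 1) then (if b.1.1 = b.1.2 then -1 else 1) else (if b.1.2 = 1 then 1 else -1)) *
        A (a.1 + b.1) (b.2 - a.2))) :
    ∃ a b c d : ZMod 167 → ℤ, IsHadamardMatrix (itoMatrix a b c d) :=
  hadamard668_order334_iff_itoMatrix.mp
    (hadamard668_index_four_implies_order334 (hadamard668_index_four_iff_williamsonType.mpr hyp))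

/-- **Ito type ⇒ sixteen circulants (order 668, kernel)** — the Ito-type array has an automorphism of pair order `334`, so
`167` divides a pair order and gen 19's dictionary applies. -/
theorem hadamard668_itoMatrix_implies_circulantArray (hyp : ∃ a b c d : ZMod 167 → ℤ, IsHadamardMatrix (itoMatrix a b c d)) :
    ∃ x : Fin 4 → Fin 4 → ZMod 167 → ℤ,
      IsHadamardMatrix (Matrix.of fun (a b : Fin 4 × ZMod 167) => x a.1 b.1 (b.2 - a.2)) := by
  obtain ⟨ι, _, _, H, π, κ, d, e, hι, hH, haut, hord⟩ := hadamard668_order334_iff_itoMatrix.mpr hyp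
  exact hadamard668_aut167_iff_circulantArray.mp
    ⟨ι, inferInstance, inferInstance, H, π, κ, d, e, hι, hH, haut, by rw [hord]; norm_num⟩

/-- **Williamson sequences ⇒ Williamson type ⇒ Ito type ⇒ sixteen circulants**: the chain for the classical family (the first
step is gen 22's `hadamard668_normalizer_index_eight_iff_williamsonSequences` read through its `|N̄| = 8` configuration, which
contains gen 21's index-4 configuration). -/
theorem hadamard668_williamsonSequences_implies_itoMatrix
    (hW : ∃ a b c d : ZMod 167 → ℤ, Literature.Combinatorics.Designs.LegendrePairs.IsPM a ∧
      Literature.Combinatorics.Designs.LegendrePairs.IsPM b ∧ Literature.Combinatorics.Designs.LegendrePairs.IsPM c ∧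
      Literature.Combinatorics.Designs.LegendrePairs.IsPM d ∧ (∀ i, a (-i) = a i) ∧ (∀ i, b (-i) = b i) ∧
      (∀ i, c (-i) = c i) ∧ (∀ i, d (-i) = d i) ∧
      ∀ s : ZMod 167, s ≠ 0 → Literature.Combinatorics.Designs.LegendrePairs.PAF a s +
        Literature.Combinatorics.Designs.LegendrePairs.PAF b s + Literature.Combinatorics.Designs.LegendrePairs.PAF c s +
        Literature.Combinatorics.Designs.LegendrePairs.PAF d s = 0) :
    ∃ a b c d : ZMod 167 → ℤ, IsHadamardMatrix (itoMatrix a b c d) := by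
  obtain ⟨ι, _, _, H, π, κ, π₁, κ₁, π₂, κ₂, π', κ', d, e, d₁, e₁, d₂, e₂, d', e', μ, hι, hH, haut, hπ, hκ, hne, h₁, h₂,
    hc₁, hc₁', hc₂, hc₂', hi₁, hi₁', hi₂, hi₂', hne₁, hne₂, hne₁₂, -, -, -, -⟩ :=
    hadamard668_normalizer_index_eight_iff_williamsonSequences.mpr hW
  exact hadamard668_order334_iff_itoMatrix.mp (hadamard668_index_four_implies_order334
    ⟨ι, inferInstance, inferInstance, H, π, κ, π₁, κ₁, π₂, κ₂, d, e, d₁, e₁, d₂, e₂, hι, hH, haut, hπ, hκ, hne, h₁, h₂, hc₁, hc₁',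
      hc₂, hc₂', hi₁, hi₁', hi₂, hi₂', hne₁, hne₂, hne₁₂⟩)

end Summit.Ventures.DiscreteObjects.Hadamard
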